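import Mathlib
import HarnessLib
import Summits.ValiantsHypothesis.ValiantsHypothesis.Theorems.LacunarySymmetroidMatrixDescartesProductPlusOneCrossingBudget

/-!
# ValiantsHypothesis / LacunarySymmetroid — crux `MatrixDescartes` (stmt-ValiantsHypothesis-18050, V1),
# LINE (A) «product_plus_one», floor `OneChangeFloorK3` (both couplings): the SIGN OF A CROSSING is the total letter log-Wronskian

Companion of ✓ `…ProductPlusOneCrossingBudget` (`euler_pos_roots_le_budget`: `Z₊(E) ≤ B + (B+1) + 2·#U`, `U` = zeros `z` of `E = X·P′ − C ν·P`
off `Z(P)` with `E′(z)·P(z) ≥ 0`).  Here the number `E′(z)·P(z)` is computed, coupling- and level-FREE: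

* `logWronskian_mul` / `logWronskian_prod_finset` / `theta_wronskian_prod` — Leibniz rule `W(gh) = h²·W(g) + g²·W(h)` for the log-Wronskian
  `W(g) := g·θ(θg) − (θg)²` (`θ = X·d/dX`), hence `W(∏ f_j) = Σ_j W(f_j)·∏_{i≠j} f_i²`;
* ★ `crossing_sign` — at a zero `z` of `E`:  `z·E′(z)·P(z) = Σ_j W(f_j)(z)·∏_{i≠j} f_i(z)²`;
* `theta_fewnomial`, `logWronskian_fewnomial` — `W(Σ_l C a_l X^{d_l}) = Σ_l Σ_{l'} C(((d_l − d_{l'})²/2)·a_l a_{l'}) X^{d_l + d_{l'}}` (sign pattern =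
  that of the products `a_l a_{l'}`: one-signed rows have `W ≥ 0` on `(0,∞)` — RISERS; the budget `U` is fed by them);
* ★ `euler_pos_roots_le_of_wronskian_neg` — if the total letter log-Wronskian is NEGATIVE at every positive zero of `E` off `Z(P)` then
  `Z₊(E) ≤ B + (B + 1)`: the conclusion of ✓ `euler_pos_roots_le_general` from a POINTWISE sign at the zeros instead of a chart.

HONEST FRAMING: calculus identities + one corollary of the budget; NOT `OneChangeFloorK3`, not `stub_classRowK3`, not `stub_polyLaw`, not
`MatrixDescartes`, not Conjecture B; `VP ≠ VNP` is NOT proved.  No definitions, no named facts.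
-/

set_option linter.dupNamespace false

namespace Summit.ValiantsHypothesis.ValiantsHypothesis.Theorems.LacunarySymmetroidMatrixDescartes

namespace ProductPlusOne

open Polynomial Finset
open scoped BigOperators Topology

/-! ### §1 The letter log-Wronskian and the sign of a crossing -/

/-- **Leibniz rule for the log-Wronskian `W(g) = g·θ(θg) − (θg)²`, `θ = X·d/dX`:** `W(gh) = h²·W(g) + g²·W(h)`. [folklore] -/
theorem logWronskian_mul (g h : ℝ[X]) :
    (g * h) * (X * derivative (X * derivative (g * h))) - (X * derivative (g * h)) ^ 2
      = h ^ 2 * (g * (X * derivative (X * derivative g)) - (X * derivative g) ^ 2)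
        + g ^ 2 * (h * (X * derivative (X * derivative h)) - (X * derivative h) ^ 2) := by
  simp only [derivative_mul, derivative_add, derivative_X]
  ring

/-- **The log-Wronskian of a product:** `W(∏_{j∈s} f_j) = Σ_{j∈s} W(f_j)·∏_{i∈s∖j} f_i²` (finset form). [folklore] -/
theorem logWronskian_prod_finset {ι : Type*} [DecidableEq ι] (s : Finset ι) (f : ι → ℝ[X]) :
    (∏ j ∈ s, f j) * (X * derivative (X * derivative (∏ j ∈ s, f j))) - (X * derivative (∏ j ∈ s, f j)) ^ 2
      = ∑ j ∈ s, (f j * (X * derivative (X * derivative (f j))) - (X * derivative (f j)) ^ 2)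
          * ∏ i ∈ s.erase j, (f i) ^ 2 := by
  induction s using Finset.induction_on with
  | empty => simp
  | @insert k s hk ih =>
    rw [Finset.prod_insert hk, logWronskian_mul, ih, Finset.sum_insert hk, Finset.erase_insert hk, Finset.mul_sum]
    congr 1
    · rw [Finset.prod_pow]
      ring
    · refine Finset.sum_congr rfl fun j hj => ?_
      have hjk : k ≠ j := fun h => hk (h ▸ hj)
      rw [Finset.erase_insert_of_ne hjk, Finset.prod_insert (fun h => hk (Finset.mem_of_mem_erase h))]
      ring

/-- **The log-Wronskian of a product** over `Fin m`: `W(∏ f_j) = Σ_j W(f_j)·∏_{i≠j} f_i²`. [folklore] -/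
theorem theta_wronskian_prod {m : ℕ} (f : Fin m → ℝ[X]) :
    (∏ j, f j) * (X * derivative (X * derivative (∏ j, f j))) - (X * derivative (∏ j, f j)) ^ 2
      = ∑ j, (f j * (X * derivative (X * derivative (f j))) - (X * derivative (f j)) ^ 2)
          * ∏ i ∈ Finset.univ.erase j, (f i) ^ 2 :=
  logWronskian_prod_finset Finset.univ f

/-- ★ **THE SIGN OF A CROSSING is the sign of the total letter log-Wronskian** (coupling- and level-free): at a zero `z` of
`E = X·P′ − C ν·P`,  `z · E′(z) · P(z) = W(P)(z) = Σ_j W(f_j)(z) · ∏_{i≠j} f_i(z)²`. [this file's theorem] -/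
theorem crossing_sign {m : ℕ} (f : Fin m → ℝ[X]) (ν z : ℝ)
    (hEz : (X * derivative (∏ j, f j) - C ν * ∏ j, f j).eval z = 0) :
    z * (derivative (X * derivative (∏ j, f j) - C ν * ∏ j, f j)).eval z * (∏ j, f j).eval z
      = ∑ j, ((f j * (X * derivative (X * derivative (f j))) - (X * derivative (f j)) ^ 2).eval z
          * ∏ i ∈ Finset.univ.erase j, ((f i).eval z) ^ 2) := by
  have hW := congrArg (Polynomial.eval z) (theta_wronskian_prod f)
  rw [eval_finsetSum] at hW
  simp only [eval_mul, eval_prod, eval_pow] at hW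
  simp only [eval_sub, eval_mul, eval_X, eval_C, eval_pow] at hEz hW ⊢
  rw [← hW]
  simp only [derivative_sub, derivative_mul, derivative_X, derivative_C, zero_mul, zero_add, one_mul, eval_add, eval_sub,
    eval_mul, eval_X, eval_C]
  linear_combination (z * (derivative (∏ j, f j)).eval z) * hEz

/-- **`θ` of a fewnomial:** `X·(Σ_l C b_l X^{d_l})′ = Σ_l C(b_l·d_l) X^{d_l}`. [folklore] -/
theorem theta_fewnomial {K : ℕ} (d : Fin K → ℕ) (b : Fin K → ℝ) :
    X * derivative (∑ l, C (b l) * X ^ (d l) : ℝ[X]) = ∑ l, C (b l * (d l : ℝ)) * X ^ (d l) := by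
  ext i
  have h := coeff_euler (∑ l, C (b l) * X ^ (d l) : ℝ[X]) 0 i
  rw [Nat.cast_zero, map_zero, zero_mul, sub_zero, sub_zero] at h
  rw [h, finsetSum_coeff, finsetSum_coeff, Finset.mul_sum]
  refine Finset.sum_congr rfl (fun l _ => ?_)
  rw [coeff_C_mul_X_pow, coeff_C_mul_X_pow]
  split_ifs with hi
  · rw [hi]; ring
  · rw [mul_zero]

/-- **The log-Wronskian of a fewnomial** is the symmetrised double sum
`W(Σ_l C a_l X^{d_l}) = Σ_l Σ_{l'} C(((d_l − d_{l'})²/2)·a_l·a_{l'}) X^{d_l + d_{l'}}` — for a ONE-SIGNED coefficient row every term is `≥ 0` on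
`(0,∞)`; in general its sign pattern is that of the products `a_l a_{l'}`. [folklore] -/
theorem logWronskian_fewnomial {K : ℕ} (d : Fin K → ℕ) (a : Fin K → ℝ) :
    (∑ l, C (a l) * X ^ (d l) : ℝ[X]) * (X * derivative (X * derivative (∑ l, C (a l) * X ^ (d l) : ℝ[X])))
        - (X * derivative (∑ l, C (a l) * X ^ (d l) : ℝ[X])) ^ 2
      = ∑ l, ∑ l', C (((d l : ℝ) - d l') ^ 2 / 2 * (a l * a l')) * X ^ (d l + d l') := by
  rw [theta_fewnomial, theta_fewnomial]
  -- both sides as double sums; symmetrise the left one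
  have hL : (∑ l, C (a l) * X ^ (d l) : ℝ[X]) * (∑ l, C (a l * (d l : ℝ) * (d l : ℝ)) * X ^ (d l))
        - (∑ l, C (a l * (d l : ℝ)) * X ^ (d l)) ^ 2
      = ∑ l, ∑ l', C ((d l' : ℝ) * (d l') * (a l * a l') - (d l : ℝ) * (d l') * (a l * a l')) * X ^ (d l + d l') := by
    rw [sq, Finset.sum_mul_sum, Finset.sum_mul_sum, ← Finset.sum_sub_distrib]
    refine Finset.sum_congr rfl fun l _ => ?_
    rw [← Finset.sum_sub_distrib]
    refine Finset.sum_congr rfl fun l' _ => ?_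
    simp only [map_sub, map_mul, pow_add]
    ring
  have hsymm : (∑ l, ∑ l', C ((d l' : ℝ) * (d l') * (a l * a l') - (d l : ℝ) * (d l') * (a l * a l')) * X ^ (d l + d l') : ℝ[X])
      = ∑ l, ∑ l', C ((d l : ℝ) * (d l) * (a l * a l') - (d l' : ℝ) * (d l) * (a l * a l')) * X ^ (d l + d l') := by
    rw [Finset.sum_comm]
    refine Finset.sum_congr rfl fun l _ => Finset.sum_congr rfl fun l' _ => ?_
    rw [add_comm (d l') (d l), mul_comm (a l') (a l)]
  rw [hL]
  have h2 : (∑ l, ∑ l', C ((d l' : ℝ) * (d l') * (a l * a l') - (d l : ℝ) * (d l') * (a l * a l')) * X ^ (d l + d l') : ℝ[X])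
      + ∑ l, ∑ l', C ((d l : ℝ) * (d l) * (a l * a l') - (d l' : ℝ) * (d l) * (a l * a l')) * X ^ (d l + d l')
      = 2 * ∑ l, ∑ l', C (((d l : ℝ) - d l') ^ 2 / 2 * (a l * a l')) * X ^ (d l + d l') := by
    rw [Finset.mul_sum, ← Finset.sum_add_distrib]
    refine Finset.sum_congr rfl fun l _ => ?_
    rw [Finset.mul_sum, ← Finset.sum_add_distrib]
    refine Finset.sum_congr rfl fun l' _ => ?_
    rw [← add_mul, ← map_add, ← mul_assoc (2 : ℝ[X]), show (2 : ℝ[X]) = C 2 from rfl, ← map_mul]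
    congr 2
    ring
  rw [← hsymm] at h2
  have h3 : (2 : ℝ[X]) * (∑ l, ∑ l', C ((d l' : ℝ) * (d l') * (a l * a l') - (d l : ℝ) * (d l') * (a l * a l')) * X ^ (d l + d l'))
      = 2 * ∑ l, ∑ l', C (((d l : ℝ) - d l') ^ 2 / 2 * (a l * a l')) * X ^ (d l + d l') := by
    rw [two_mul]; exact h2
  exact mul_left_cancel₀ two_ne_zero h3

/-! ### §2 The first corollary: a pointwise sign at the zeros suffices -/

/-- ★ **Monotonicity is not needed, only the sign at the zeros:** if the total letter log-Wronskian
`Σ_j W(f_j)(z)·∏_{i≠j} f_i(z)²` is NEGATIVE at every positive zero of `E` off `Z(P)`, then `Z₊(E) ≤ B + (B + 1)` — the conclusion of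
✓ `euler_pos_roots_le_general` (there: `Φ` injective on zero-free intervals). [this file's theorem] -/
theorem euler_pos_roots_le_of_wronskian_neg {m : ℕ} (f : Fin m → ℝ[X]) (hP0 : (∏ j, f j) ≠ 0) (ν : ℝ) (B : ℕ)
    (hZ : ((∏ j, f j).roots.toFinset.filter (fun t => 0 < t)).card ≤ B)
    (hneg : ∀ z : ℝ, 0 < z → (∏ j, f j).eval z ≠ 0 → (X * derivative (∏ j, f j) - C ν * ∏ j, f j).eval z = 0 →
      ∑ j, ((f j * (X * derivative (X * derivative (f j))) - (X * derivative (f j)) ^ 2).eval z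
          * ∏ i ∈ Finset.univ.erase j, ((f i).eval z) ^ 2) < 0) :
    ((X * derivative (∏ j, f j) - C ν * ∏ j, f j).roots.toFinset.filter (fun t => 0 < t)).card ≤ B + (B + 1) := by
  classical
  have h := euler_pos_roots_le_budget f hP0 ν B hZ
  set E : ℝ[X] := X * derivative (∏ j, f j) - C ν * ∏ j, f j with hE
  have hU : (E.roots.toFinset.filter (fun z => 0 < z ∧ (∏ j, f j).eval z ≠ 0 ∧
      0 ≤ (derivative E).eval z * (∏ j, f j).eval z)) = ∅ := by
    rw [Finset.filter_eq_empty_iff]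
    rintro z hz ⟨hz0, hPz, hge⟩
    by_cases hE0 : E = 0
    · rw [hE0, roots_zero, Multiset.toFinset_zero] at hz; exact absurd hz (Finset.notMem_empty _)
    rw [Multiset.mem_toFinset, mem_roots hE0] at hz
    have hs := crossing_sign f ν z hz
    have hlt := hneg z hz0 hPz hz
    rw [← hs] at hlt
    have : 0 ≤ z * ((derivative E).eval z * (∏ j, f j).eval z) := mul_nonneg hz0.le hge
    rw [← mul_assoc] at this
    exact absurd hlt (not_lt.mpr this)
  rw [hU, Finset.card_empty, mul_zero, add_zero] at h
  exact h

/-! ### §3 (appended 2026-08-29, val-lit-p5 g14) The log-Wronskian at a pole — val-idea-25 g3's AB5-0′ -/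

/-- **At a zero `t` of the factor `f_i` the total log-Wronskian is `≤ 0`:**
`W(∏ f_j)(t) = −((X·f_i′)(t))²·∏_{k≠i} f_k(t)²`.  (Every term `j ≠ i` of ✓ `theta_wronskian_prod` carries the factor `f_i(t)² = 0`, and
`W(f_i)(t) = f_i(t)·θ²f_i(t) − (θf_i(t))² = −(θf_i(t))²`.)  Hence every component of `{W(P) > 0}` lies inside ONE pole-free window
(val-idea-25 g3 AB5-0′). [this file's theorem] -/
theorem theta_wronskian_eval_at_root {m : ℕ} (f : Fin m → ℝ[X]) (i : Fin m) {t : ℝ} (hfi : (f i).eval t = 0) :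
    ((∏ j, f j) * (X * derivative (X * derivative (∏ j, f j))) - (X * derivative (∏ j, f j)) ^ 2).eval t
      = -((X * derivative (f i)).eval t) ^ 2 * ∏ k ∈ Finset.univ.erase i, ((f k).eval t) ^ 2 := by
  classical
  rw [theta_wronskian_prod, eval_finsetSum]
  rw [Finset.sum_eq_single i]
  · simp only [eval_mul, eval_sub, eval_pow, eval_prod, hfi, zero_mul, zero_sub]
  · intro j _ hji
    simp only [eval_mul, eval_prod]
    have hmem : i ∈ Finset.univ.erase j := Finset.mem_erase.mpr ⟨Ne.symm hji, Finset.mem_univ i⟩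
    have : (∏ k ∈ Finset.univ.erase j, ((f k) ^ 2).eval t) = 0 :=
      Finset.prod_eq_zero hmem (by simp [eval_pow, hfi])
    rw [this, mul_zero]
  · intro h; exact absurd (Finset.mem_univ i) h

/-- **Corollary (AB5-0′):** at a positive zero of some factor the total log-Wronskian `W(P)` is `≤ 0`; so `{W(P) > 0} ∩ (0,∞)` does not meet the
poles and each of its components sits in one pole-free window. [this file's theorem] -/
theorem theta_wronskian_nonpos_at_root {m : ℕ} (f : Fin m → ℝ[X]) (i : Fin m) {t : ℝ} (hfi : (f i).eval t = 0) :
    ((∏ j, f j) * (X * derivative (X * derivative (∏ j, f j))) - (X * derivative (∏ j, f j)) ^ 2).eval t ≤ 0 := by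
  rw [theta_wronskian_eval_at_root f i hfi]
  have h1 : 0 ≤ ((X * derivative (f i)).eval t) ^ 2 := sq_nonneg _
  have h2 : 0 ≤ ∏ k ∈ Finset.univ.erase i, ((f k).eval t) ^ 2 := Finset.prod_nonneg fun k _ => sq_nonneg _
  nlinarith [mul_nonneg h1 h2]

end ProductPlusOne

end Summit.ValiantsHypothesis.ValiantsHypothesis.Theorems.LacunarySymmetroidMatrixDescartes
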